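import Summits.BirchSwinnertonDyer.BirchSwinnertonDyer.Theorems.KatoDescentPotSupersingularReducibleKatoMemberNodes
import Summits.BirchSwinnertonDyer.BirchSwinnertonDyer.Theorems.KatoDescentPotSupersingularIntegralH1RankZero
import Literature.NumberTheory.EllipticCurves.Kato2004.MemberHullZetaInputs
import Literature.NumberTheory.EllipticCurves.Kato2004.IwasawaCohomologyExistsProofs
import HarnessLib

/-!
# Cell `bsd-potss`, routes `KatoDescentPotSupersingular` (K9) / `KatoDescentTamePotSupersingular` (K8-t′):
# the node `O6.KatoMemberShaBoundOfReducible` (= the SHARED crux M `ReducibleKatoMember`, item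
# stmt-BirchSwinnertonDyer-19196) FROM THE ZETA-ONLY INPUTS AT KATO'S MEMBER — ROUTE-FREE module
# `exists_isNewformOf → exists_memberHullZetaInputs → rank_eq_analyticRank_of_analyticRank_le_one →
# O6.KatoMemberShaBoundOfReducible`

Seat `bsd-potss-rkm` generation 10.  The held input of crux M 19196 was the named fact
`Kato2004.exists_memberHullInputs` (item 19659); on rkm g8/g9's recommendation the planner (g22, cite
wi-78945) had it RE-TYPED as the ZETA-ONLY sibling `Kato2004.exists_memberHullZetaInputs` (file
`Kato2004/MemberHullZetaInputs.lean`, p519008): the same `∀∃` shell with the structure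
`MemberHullZetaInputs` that DROPS the four algebraic clauses `finite_H` ((12.2.1)), `torsionFree_H`
(Thm. 12.4 (2)), `ι_injective` ((14.14.1) left exactness), `finite_coinvariants_H2` (Thm. 14.5 (1)) — all
four are theorems of the tree on every cyclotomic pin (p510488, p491527, p510488, p517108).  That file
proves the kernel theorem
`exists_memberHullInputs_of_zetaInputs (hGZK) (hR0) : exists_memberHullZetaInputs → exists_memberHullInputs`
with the base-level bound (R0) «`W(ℚ)` finite → `Ш(W)[p^∞]` finite → `rank_{ℤ_p} H¹(ℤ[1/p],T_pW) ≤ 1`»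
DISPLAYED as the hypothesis `hR0` (a Literature file cannot import the Summits theorem).  This module
discharges `hR0` by rkm g9's `IntegralH1RankZero.rank_integralH1_layerZero_le_one` (Kato 14.13 / Thm.
14.5 (1) in rank `0`, Euler-system-free), discharges `nonempty_iwasawaH1Data` by rkm g4's
`Kato2004.nonempty_iwasawaH1Data_holds`, and composes with the route-free node theorem
`ReducibleKatoMemberOfInputs.katoMemberShaBoundOfReducible_of_memberHullInputs` (rkm g3 / kmc g9).

Result: the node T-X3K = crux M now rests on exactly THREE named facts — modularity
(`exists_isNewformOf`), Gross–Zagier–Kolyvagin (`rank_eq_analyticRank_of_analyticRank_le_one`, already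
an input of both routes) and the zeta-only transcription `exists_memberHullZetaInputs` of Kato Thm.
12.5 / 12.6 / 13.10 (1) / 13.14 / 14.5 (2) / 14.16 (2) at the member.  CONDITIONAL (audit
`proof.conditional`) on those; no item is closed by this file; the route-typed one-line closers of the
planner's glue `ReducibleKatoMemberOfZetaInputs(T)` are the sibling files
`KatoDescent{,Tame}PotSupersingularReducibleKatoMemberOfZetaInputs.lean`.  HONEST FRAMING: BSD is not
advanced; nothing is booked; M's non-CM rows remain "Kato's Euler-system bound at an additive prime with
`E[p]` reducible", with four module-theoretic clauses moved out of hypothesis position.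

References: [Kato2004Asterisque] (12.2.1) (p. 220), Thm. 12.4 (p. 221), Thm. 12.5–12.6 (pp. 221–222),
Lemma 13.10 (1) (p. 230), 13.14 (p. 234), Thm. 14.5 (p. 236), 14.13 and §14.14 (p. 243), Prop. 14.16 (2)
(p. 244); [Wuthrich2014] Lemma 12, Lemma 14; [Darmon2004] Thm. 3.22 (Gross–Zagier–Kolyvagin);
[DiamondShurman2005] Thm. 8.8.3.
-/

set_option autoImplicit false
-- sibling precedent (`KatoDescentPotSupersingularReducibleKatoMemberOfInputs.lean`): the directory name
-- repeats the summit name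
set_option linter.dupNamespace false

noncomputable section

namespace Summit.BirchSwinnertonDyer.BirchSwinnertonDyer.Theorems.ReducibleOfZetaInputs

open Literature.NumberTheory.GaloisRepresentations
open Literature.NumberTheory.EllipticCurves Literature.NumberTheory.EllipticCurves.ModularForms
  Literature.NumberTheory.EllipticCurves.Kato2004
  Literature.NumberTheory.EllipticCurves.Kato2004.EulerSystemValues
open Summit.BirchSwinnertonDyer.BirchSwinnertonDyer.Theorems.IntegralH1RankZero

/-- **(R0) in the displayed shape of `Kato2004.exists_memberHullInputs_of_zetaInputs`'s hypothesis `hR0`**: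
for every `W/ℚ`, prime `p`, `ℤ_p`-extension `κ`, with `W(ℚ)` and `Ш(W)[p^∞]` finite,
`rank_{ℤ_p} H¹(ℤ[1/p], T_pW) ≤ 1` at the bottom layer — rkm g9's
`IntegralH1RankZero.rank_integralH1_layerZero_le_one`, binder for binder.
[cite: Kato2004Asterisque, Thm. 14.5 (1) (p. 236) and 14.13 (p. 243)] -/
theorem hR0_holds :
    ∀ (W : WeierstrassCurve ℚ) [W.IsElliptic] (p : ℕ) [Fact p.Prime]
      [ContinuousSMul ℤ_[p] (W.tateModule p)] (κ : ZpExtension ℚ p) [Finite W.toAffine.Point]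
      [Finite (AddCommGroup.primaryComponent W.sha p)],
      Module.rank ℤ_[p] (integralH1 (tateRep W p) p (κ.layerSubgroup 0)) ≤ 1 :=
  fun W _ p _ _ κ _ _ => rank_integralH1_layerZero_le_one W p κ

/-- **The superseded held input from the new one**: `exists_memberHullZetaInputs →
rank_eq_analyticRank_of_analyticRank_le_one → exists_memberHullInputs` — the typer's kernel theorem with
`hR0` discharged by (R0).  So item 19659's fact is implied by the zeta fact and GZK (documentary; 19659
leaves the cone as superseded, never refuted).
[cite: Kato2004Asterisque, (12.2.1) (p. 220), Thm. 12.4 (2) (p. 221), Thm. 14.5 (1) (p. 236), §14.14 (14.14.1)–(14.14.2) (p. 243)]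
[cite: Darmon2004, Thm. 3.22] -/
theorem exists_memberHullInputs_of_zetaInputs_of_GZK (hZ : Kato2004.exists_memberHullZetaInputs)
    (hGZK : rank_eq_analyticRank_of_analyticRank_le_one) : Kato2004.exists_memberHullInputs :=
  Kato2004.exists_memberHullInputs_of_zetaInputs hGZK hR0_holds hZ

/-- **The node T-X3K = crux M from the zeta-only inputs**: `exists_isNewformOf →
exists_memberHullZetaInputs → rank_eq_analyticRank_of_analyticRank_le_one →
O6.KatoMemberShaBoundOfReducible`.  `nonempty_iwasawaH1Data` is discharged by
`Kato2004.nonempty_iwasawaH1Data_holds` (rkm g4), (R0) by `hR0_holds` (rkm g9), and the descent is the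
route-free node theorem `ReducibleKatoMemberOfInputs.katoMemberShaBoundOfReducible_of_memberHullInputs`.
Conditional on the three named facts; nothing else assumed.
[cite: Kato2004Asterisque, Thm. 12.6 (p. 222), Lemma 13.10 (1) (p. 230), 13.14 (p. 234), §14.14 and Lemma 14.15 (pp. 243–244), Prop. 14.16 (2) (p. 244)]
[cite: Wuthrich2014, Lemma 14 (p. 396)] [cite: Darmon2004, Thm. 3.22] -/
theorem katoMemberShaBoundOfReducible_of_memberHullZetaInputs (hmod : exists_isNewformOf)
    (hZ : Kato2004.exists_memberHullZetaInputs) (hGZK : rank_eq_analyticRank_of_analyticRank_le_one) :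
    Summit.BirchSwinnertonDyer.Rank1Residual.O6.KatoMemberShaBoundOfReducible :=
  ReducibleKatoMemberOfInputs.katoMemberShaBoundOfReducible_of_memberHullInputs
    Kato2004.nonempty_iwasawaH1Data_holds hmod (exists_memberHullInputs_of_zetaInputs_of_GZK hZ hGZK)

/-- **Four-hypothesis form in the order of the planner's resplit** (`PublishedInputIwasawaH1Data →
PublishedInputNewformKato → PublishedInputMemberHullZetaInputs → PublishedInputRankEqAnalyticRankW →
M`): `nonempty_iwasawaH1Data → exists_isNewformOf → exists_memberHullZetaInputs →
rank_eq_analyticRank_of_analyticRank_le_one → O6.KatoMemberShaBoundOfReducible` (the first hypothesis is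
not used: it is a theorem).  Conditional; nothing else assumed.
[cite: Kato2004Asterisque, Thm. 12.6 (p. 222), Prop. 14.16 (2) (p. 244)] [cite: Wuthrich2014, Lemma 14 (p. 396)] -/
theorem katoMemberShaBoundOfReducible_of_zetaInputs (_hne : Kato2004.nonempty_iwasawaH1Data)
    (hmod : exists_isNewformOf) (hZ : Kato2004.exists_memberHullZetaInputs)
    (hGZK : rank_eq_analyticRank_of_analyticRank_le_one) :
    Summit.BirchSwinnertonDyer.Rank1Residual.O6.KatoMemberShaBoundOfReducible :=
  katoMemberShaBoundOfReducible_of_memberHullZetaInputs hmod hZ hGZK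

/-- **Conjunction form**: `(exists_isNewformOf ∧ exists_memberHullZetaInputs ∧
rank_eq_analyticRank_of_analyticRank_le_one) → O6.KatoMemberShaBoundOfReducible`.  Conditional; nothing
else assumed. [cite: Kato2004Asterisque, Thm. 12.6 (p. 222), Prop. 14.16 (2) (p. 244)] -/
theorem katoMemberShaBoundOfReducible_of_zetaInputs_and
    (h : exists_isNewformOf ∧ Kato2004.exists_memberHullZetaInputs ∧
      rank_eq_analyticRank_of_analyticRank_le_one) :
    Summit.BirchSwinnertonDyer.Rank1Residual.O6.KatoMemberShaBoundOfReducible :=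
  katoMemberShaBoundOfReducible_of_memberHullZetaInputs h.1 h.2.1 h.2.2

end Summit.BirchSwinnertonDyer.BirchSwinnertonDyer.Theorems.ReducibleOfZetaInputs

end
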